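import Summits.QuantumFields.BalabanUV.T4Continuum.Support.NE3CpushGaugeCovariance
import Summits.QuantumFields.BalabanUV.T4Continuum.Support.NE3TangentCovariantTower
import HarnessLib

/-!
# T⁴ programme, node NE3 — route Π, row Π-R (curved step), file Π-R-W4c⁰: FINITE GAUGE COVARIANCE OF THE LINEARISED TRANSPORT, OF THE
# LINEARISED FRAMES AND OF THE (k-FOLD) LINEARISED DOUBLE-BAR AVERAGE — `QbarIter L k (W^u) (Y^u) = (QbarIter L k W Y)^{u ∘ L^k•}`

NE3 (node U1b) formalisation swarm, leaf seat `b2b-balaban-t4-ne3-formalise-leaf-01` (gen 8); re-planned row Π-R-W (FINDING F-ne3leaf01g8-1,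
`HOME/CLAIMS.log` 2026-08-20 ≈23:04Z).  The companion of g7's W1 (`NE3CpushGaugeCovariance`: `pushDir`∕`cpush`∕`cavgIter`∕`dirIter` dress
covariantly) for the NON-gauge part of leaf-04's split `cpush = Qbar + gaugeDir ∘ Fbar`: the linearised transport `dhol` along any word, the linearised
frame `frameLin`∕`Fbar`, hence `dbarLin`∕`Qbar`, and through the tower `QbarIter`, all dress covariantly under an ARBITRARY (not necessarily periodic)
unitary gauge function `u` — the input that lets the crux estimate W4c move the reading of one coarse bond into a REGIONAL comb gauge.

CONTENT ([folklore]; 0 sorry; 0 def): `dhol_gaugeAct` (induction on the word: `dstep`∕`stepHol` dress by (8)), `frameLin_gaugeAct`, `Fbar_gaugeAct`,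
`dbarLin_gaugeAct` (W1 `pushDir_gaugeAct` + `B7Prop1Explicit.bavg_gaugeAct` in the loop ball of the small-field class), **`Qbar_gaugeAct`**,
**`QbarIter_gaugeAct`** (the class persists under averaging: `step_small`; `cavg_gaugeAct`).

HONEST FRAMING.  Kinematic identities at one background; nothing about minimisers; (P♮)_W, T-E_w and **NE3 are NOT proved**; spine PROVED 0∕9; finite
T⁴ rung (B)+1 — NOT infinite volume, NOT mass gap, NOT `BetaPertH`, NOT Clay.  PLACEMENT: `Summits/QuantumFields/BalabanUV/`.  HONEST DEPENDENCY (cell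
page 1): continuum YM on T⁴ ⇐ BetaPertH ∧ nine spine estimates (0/9 proved); BetaPertH ⇐ (D1) ∧ (D4) ∧ CAP+tail; G-an2-4 gates asym, D1 and NE2/3/4.
-/

set_option autoImplicit false

open scoped BigOperators Matrix.Norms.L2Operator
open Finset

namespace Summit.QuantumFields.BalabanUV.T4Continuum.NE3QbarGaugeCovariance

open Literature.MathematicalPhysics.QuantumFieldTheory.Balaban1983to89
open B7Prop1Explicit B7Prop2Explicit
open T4AveragingDeficitWall (IsUnitaryCfg SmallField Ad norm_Wcx_sub_one_lt_one_of_smallField)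
open T4AveragingDeficitNonAbelian (Ad_mul Ad_sub)
open AveragingDeficitTransport (dhol dhol_nil dhol_cons dstep mem_U1_of_unitary)
open AveragingDeficitNearIdentity (Ad_add Ad_one Ad_zero Ad_neg Ad_real_smul Ad_sum)
open AveragingDeficitResidualPairing (pushDir)
open AveragingDeficitChartCalculus (cavg)
open AveragingDeficitMultiLevelPrep (cavgIter LevelSmall)
open BlockAveragePushDirSplit (frameLin dbarLin)
open NE3TangentCovariantStructure (Qbar Fbar)
open NE3TangentCovariantTower (QbarIter step_small)
open NE3NestedBlockMeanCovariance (cavg_gaugeAct)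
open NE3CpushGaugeCovariance (pushDir_gaugeAct)

noncomputable section

variable {d : ℕ} {n : Type*} [Fintype n] [DecidableEq n]

/-! ## §1 The linearised transport along a word -/

/-- `Ad_{a·b⁻¹} (Ad_b X) = Ad_a X`. [folklore] -/
theorem Ad_mul_inv_Ad (a b : (Matrix n n ℂ)ˣ) (X : Matrix n n ℂ) : Ad (a * b⁻¹) (Ad b X) = Ad a X := by
  rw [← Ad_mul, inv_mul_cancel_right]

/-- **THE LINEARISED TRANSPORT DRESSES COVARIANTLY** (any gauge function `u`, any word): for the dressed direction `ψ^u(x,μ) = Ad_{u(x+e_μ)} ψ(x,μ)`,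
`(δ_{ψ^u} W^u)(Γ from x) = Ad_{u(x)} (δ_ψ W)(Γ from x)`. [cite: Balaban1985Averaging, (8) p.18] -/
theorem dhol_gaugeAct (u : Site d → (Matrix n n ℂ)ˣ) (W : Site d → Fin d → (Matrix n n ℂ)ˣ) (ψ : Site d → Fin d → Matrix n n ℂ) :
    ∀ (x : Site d) (w : List (Letter d)),
      dhol (gaugeAct u W) (fun y μ => Ad (u (y + e μ)) (ψ y μ)) x w = Ad (u x) (dhol W ψ x w)
  | x, [] => by rw [dhol_nil, dhol_nil, Ad_zero]
  | x, l :: w => by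
    rw [dhol_cons, dhol_cons, dhol_gaugeAct u W ψ (x + l.vec) w, stepHol_gaugeAct, Ad_add, Ad_mul_inv_Ad, Ad_mul]
    congr 1
    obtain ⟨μ, b⟩ := l
    cases b
    · simp only [dstep, Bool.false_eq_true, ↓reduceIte, Letter.vec, Ad_neg]
      congr 2
      simp
    · simp only [dstep, ↓reduceIte, gaugeAct, Ad_mul]
      rw [← Ad_mul (u (x + e μ))⁻¹, inv_mul_cancel, Ad_one]

/-- **THE LINEARISED FRAME DRESSES COVARIANTLY**: `frameLin L (W^u) (ψ^u) y = Ad_{u(y)} (frameLin L W ψ y)`. [folklore] -/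
theorem frameLin_gaugeAct (L : ℕ) (u : Site d → (Matrix n n ℂ)ˣ) (W : Site d → Fin d → (Matrix n n ℂ)ˣ) (ψ : Site d → Fin d → Matrix n n ℂ)
    (y : Site d) : frameLin L (gaugeAct u W) (fun x μ => Ad (u (x + e μ)) (ψ x μ)) y = Ad (u y) (frameLin L W ψ y) := by
  unfold frameLin
  rw [Ad_sum]
  exact Finset.sum_congr rfl fun r _ => by rw [dhol_gaugeAct, Ad_real_smul]

/-- `Fbar L (W^u) (ψ^u) z = Ad_{u(L•z)} (Fbar L W ψ z)`. [folklore] -/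
theorem Fbar_gaugeAct (L : ℕ) (u : Site d → (Matrix n n ℂ)ˣ) (W : Site d → Fin d → (Matrix n n ℂ)ˣ) (ψ : Site d → Fin d → Matrix n n ℂ)
    (z : Site d) : Fbar L (gaugeAct u W) (fun x μ => Ad (u (x + e μ)) (ψ x μ)) z = Ad (u ((L : ℤ) • z)) (Fbar L W ψ z) :=
  frameLin_gaugeAct L u W ψ _

/-! ## §2 The linearised double-bar average, one level and through the tower -/

section Class

variable [Nonempty n] {L : ℕ} (hL : 1 ≤ L)

include hL in
/-- **`dbarLin` DRESSES COVARIANTLY** (in the loop ball of the small-field class):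
`dbarLin L (W^u) (ψ^u) (q,κ) = Ad_{u(q + Le_κ)} (dbarLin L W ψ (q,κ))`. [cite: Balaban1985Averaging, (45) p.24] -/
theorem dbarLin_gaugeAct {W : Site d → Fin d → (Matrix n n ℂ)ˣ} (hWu : IsUnitaryCfg W) {a : ℝ} (ha : 0 ≤ a)
    (h512 : 512 * (d + 1) * (d + 4) * (L : ℝ) ^ 2 * a ≤ 1) (hWa : SmallField W a)
    {u : Site d → (Matrix n n ℂ)ˣ} (hu : ∀ x, u x ∈ unitaryUnits (Matrix n n ℂ)) (ψ : Site d → Fin d → Matrix n n ℂ) (q : Site d) (κ : Fin d) :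
    dbarLin L (gaugeAct u W) (fun x μ => Ad (u (x + e μ)) (ψ x μ)) q κ = Ad (u (q + (L : ℤ) • e κ)) (dbarLin L W ψ q κ) := by
  have hW := fun r => norm_Wcx_sub_one_lt_one_of_smallField L hL hWu ha h512 hWa q κ r
  unfold dbarLin
  rw [pushDir_gaugeAct L hu W ψ q κ hW, bavg_gaugeAct L (fun x => mem_U1_of_unitary (hu x)) W q κ hW, frameLin_gaugeAct, frameLin_gaugeAct,
    Ad_sub, Ad_sub, ← Ad_mul, ← Ad_mul]
  congr 3
  rw [mul_inv_rev, mul_inv_rev, inv_inv, mul_assoc, mul_assoc, inv_mul_cancel, mul_one]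

include hL in
/-- **`Qbar` DRESSES COVARIANTLY**: `Qbar L (W^u) (ψ^u) (z,κ) = Ad_{u(L•(z+e_κ))} (Qbar L W ψ (z,κ))`. [cite: Balaban1985Averaging, (45) p.24] -/
theorem Qbar_gaugeAct {W : Site d → Fin d → (Matrix n n ℂ)ˣ} (hWu : IsUnitaryCfg W) {a : ℝ} (ha : 0 ≤ a)
    (h512 : 512 * (d + 1) * (d + 4) * (L : ℝ) ^ 2 * a ≤ 1) (hWa : SmallField W a)
    {u : Site d → (Matrix n n ℂ)ˣ} (hu : ∀ x, u x ∈ unitaryUnits (Matrix n n ℂ)) (ψ : Site d → Fin d → Matrix n n ℂ) :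
    Qbar L (gaugeAct u W) (fun x μ => Ad (u (x + e μ)) (ψ x μ)) = fun z κ => Ad (u ((L : ℤ) • (z + e κ))) (Qbar L W ψ z κ) := by
  funext z κ
  show dbarLin L (gaugeAct u W) (fun x μ => Ad (u (x + e μ)) (ψ x μ)) ((L : ℤ) • z) κ = _
  rw [dbarLin_gaugeAct hL hWu ha h512 hWa hu ψ _ κ, smul_add]
  rfl

include hL in
/-- **THE k-FOLD LINEARISED DOUBLE-BAR AVERAGE DRESSES COVARIANTLY** (multi-level small-field class; ANY unitary `u`):
`QbarIter L (j+1) (W^u) (ψ^u) = (QbarIter L (j+1) W ψ)^{u ∘ L^{j+1}•}`. [cite: Balaban1985Averaging, (45) p.24] -/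
theorem QbarIter_gaugeAct (j : ℕ) :
    ∀ {W : Site d → Fin d → (Matrix n n ℂ)ˣ} {x : ℝ}, IsUnitaryCfg W → 0 ≤ x → LevelSmall d L j x → SmallField W x →
    ∀ {u : Site d → (Matrix n n ℂ)ˣ}, (∀ y, u y ∈ unitaryUnits (Matrix n n ℂ)) → ∀ (ψ : Site d → Fin d → Matrix n n ℂ),
      QbarIter L (j + 1) (gaugeAct u W) (fun y μ => Ad (u (y + e μ)) (ψ y μ))
        = fun z κ => Ad (u (((L : ℤ) ^ (j + 1)) • (z + e κ))) (QbarIter L (j + 1) W ψ z κ) := by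
  induction j with
  | zero =>
      intro W x hWu hx hs hWx u hu ψ
      obtain ⟨h512, -, -, -⟩ := step_small hL hWu hx hs hWx
      simp only [zero_add, pow_one]
      exact Qbar_gaugeAct hL hWu hx h512 hWx hu ψ
  | succ j ih =>
      intro W x hWu hx hs hWx u hu ψ
      obtain ⟨h512, hW₁u, hr0, hW₁x⟩ := step_small hL hWu hx hs.1 hWx
      have hu₁ : ∀ y, (fun w => u ((L : ℤ) • w)) y ∈ unitaryUnits (Matrix n n ℂ) := fun y => hu _
      show QbarIter L (j + 1) (cavg L (gaugeAct u W)) (Qbar L (gaugeAct u W) (fun y μ => Ad (u (y + e μ)) (ψ y μ))) = _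
      rw [cavg_gaugeAct hL hWu hx h512 hWx hu, Qbar_gaugeAct hL hWu hx h512 hWx hu ψ]
      have h := ih hW₁u hr0 hs.2 hW₁x hu₁ (Qbar L W ψ)
      have hfun : (fun z κ => Ad (u ((L : ℤ) • (z + e κ))) (Qbar L W ψ z κ)) = fun y μ => Ad ((fun w => u ((L : ℤ) • w)) (y + e μ)) (Qbar L W ψ y μ) := rfl
      rw [hfun, h]
      funext z κ
      show Ad (u ((L : ℤ) • (((L : ℤ) ^ (j + 1)) • (z + e κ)))) (QbarIter L (j + 1) (cavg L W) (Qbar L W ψ) z κ) = _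
      rw [smul_smul, ← pow_succ']
      rfl

end Class

end

end Summit.QuantumFields.BalabanUV.T4Continuum.NE3QbarGaugeCovariance
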